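import Mathlib
import HarnessLib
import Summits.CriticalPhenomena.Ising3DConformalLimit.Theorems.HyperoctahedralRPTwoPointKernelOfLimitClauses
import Summits.CriticalPhenomena.Ising3DConformalLimit.Theorems.HyperoctahedralRPTwoPointLimitIsotropicHolds
import Summits.CriticalPhenomena.Ising3DConformalLimit.Theorems.HarmonicMomentsIsotropyTwoPointAsymptoticIsotropyLatticeIntegral
import Summits.CriticalPhenomena.Ising3DConformalLimit.Theorems.HarmonicMomentsIsotropyTwoPointAsymptoticIsotropyBulk
import Summits.CriticalPhenomena.Ising3DConformalLimit.Theorems.HarmonicMomentsIsotropyTwoPointAsymptoticIsotropyShells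
import Summits.CriticalPhenomena.Ising3DConformalLimit.Theorems.HarmonicMomentsIsotropyTwoPointAsymptoticIsotropyDecay
import Literature.Probability.LatticeModels.HighDimPointwiseTriviality
import Literature.Probability.LatticeModels.CriticalScalingDimension
import Summits.CriticalPhenomena.Ising3DConformalLimit.Theses.HarmonicMomentsIsotropy
import Summits.CriticalPhenomena.Ising3DConformalLimit.Theorems.HarmonicMomentsIsotropyTwoPointAsymptoticIsotropyTestFunctions

/-!
# Vague asymptotic isotropy of the critical `ℤ³` two-point function from a scale-covariant limit, VI:
# the ratio theorem and `ExistsScaleCovariantLimit → TwoPointAsymptoticIsotropy`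
(route HarmonicMomentsIsotropy, support item stmt-CriticalPhenomena-6036 `TwoPointAsymptoticIsotropy`;
main file of the conditional line; files I–V are the helpers `…LatticeIntegral`, `…Bulk`, `…Shells`,
`…Decay`, `…TestFunctions`)

THE RESULT. `twoPointAsymptoticIsotropy_of_existsScaleCovariantLimit :
ExistsScaleCovariantLimit → TwoPointAsymptoticIsotropy` — both route decls verbatim. If the critical
nearest-neighbour Ising correlators on `ℤ³` admit a pointwise scaling limit (renormalisation `ρ > 0` on
`(0,1]`) which is normalised, non-degenerate, translation invariant and scale covariant (the shared
crux `ExistsScaleCovariantLimit`, item stmt-CriticalPhenomena-1981, of routes HyperoctahedralRP /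
HarmonicMomentsIsotropy), then the critical two-point function `⟨σ₀σ_x⟩_{β_c}` is asymptotically
`O(3)`-invariant in the vague sense: for every continuous compactly supported `φ ≥ 0`, `φ ≢ 0`, on
`ℝ³` and every orthogonal matrix `R`, `Σ_x φ(Rx/L)⟨σ₀σ_x⟩_{β_c} / Σ_x φ(x/L)⟨σ₀σ_x⟩_{β_c} → 1`
(`L → ∞`). Consequently the HarmonicMomentsIsotropy milestone needs, besides the shared crux, none
of the route's own cruxes (AngularHierarchy, CorrelationLengthWindow, DilutionTransfer): the
continuum two-point isotropy is already a theorem of the tree (`kernel_rotation_invariant`,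
nine-mirror reflection-positivity rigidity `HRP2Rigidity_of`), and this line is the
lattice-to-continuum transfer. The unconditional statement (rotation invariance on `ℤ³`) remains
open (Duminil-Copin, ICM 2022, §8.1).

THE PROOF (`tendsto_ratio_of_limit`, for a general linear isometry `T` of `ℝ³`). Fix the dyadic
depth `J` and split both lattice sums at `‖x‖ = 2^{-J}L`. Multiplied by `c_L = L⁻³ρ(1/L)²`, the two
bulk parts converge (file II, Riemann sums + dominated convergence from the locally uniform
scaling limit) to `∫_{‖y‖>2^{-J}} (φ∘T) K` and `∫_{‖y‖>2^{-J}} φ K`, which are EQUAL (file V: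
`K ∘ T = K` and Lebesgue measure is `T`-invariant) and positive. The origin parts are at most
`‖φ‖_∞ mass(L/2^J) ≤ ‖φ‖_∞ (mass(L₀) + 3(2/3)^J Σ_{L/2<‖x‖≤L})` (file IV: geometric decay from the
shell ratio of file III — the limiting dyadic shell ratio is `2^{2Δ-3} ≤ 1/2` because `Δ ≤ 1`), while
`c_L Σ_{L/2<‖x‖≤L} → ∫_{1/2<‖y‖≤1} K` and `c_L → 0` (file IV, Simon–Lieb lower bound); so the origin
parts are `O((2/3)^J)` relative to the bulk, uniformly in large `L`, and the ratio tends to `1`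
(`ratio_arith` is the final bookkeeping). Inputs from the tree: `HasPointwiseScalingLimit`,
`kernel_continuousOn/pos/homogeneous/rotation_invariant`, `window` (`1/2 ≤ Δ ≤ 1`),
`criticalTwoPoint_bounds_holds`, `exists_eventually_rescaled_two_le`.

References: H. Duminil-Copin, *100 years of the (critical) Ising model on the hypercubic lattice*,
ICM 2022, §8.1 [DuminilCopinICM2022]; G. B. Folland, *Real Analysis* (1999), §2.3. No definitions
are introduced.
-/

noncomputable section

namespace Summit.CriticalPhenomena.Ising3DConformalLimit.HarmonicMomentsIsotropyTwoPoint

open Literature.Probability.LatticeModels MeasureTheory Filter Set Metric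
open scoped Topology
open Summit.CriticalPhenomena.Ising3DConformalLimit.HyperoctahedralRPTwoPoint
open Summit.CriticalPhenomena.Ising3DConformalLimit.Theses.HarmonicMomentsIsotropy

local notation "E3" => EuclideanSpace ℝ (Fin 3)

/-- The indicator of the spherical shell `{a < ‖y‖ ≤ b}`. -/
local notation3 (prettyPrint := false) "shell[" a "," b "]" =>
  Set.indicator {y : EuclideanSpace ℝ (Fin 3) | a < ‖y‖ ∧ ‖y‖ ≤ b} (fun _ => (1:ℝ))

/-- The indicator of the closed ball `{‖y‖ ≤ r}`. -/
local notation3 (prettyPrint := false) "ballInd[" r "]" =>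
  Set.indicator {y : EuclideanSpace ℝ (Fin 3) | ‖y‖ ≤ r} (fun _ => (1:ℝ))

variable {ρ : ℝ → ℝ} {Δ : ℝ} {S : CorrFamily 3}

/-! ### Small arithmetic helpers -/

/-- Choice of the dyadic depth: `a (2/3)^J ≤ t` and `2^{-J} ≤ ε₁`. [folklore] -/
theorem exists_depth {a t ε₁ : ℝ} (ha : 0 ≤ a) (ht : 0 < t) (hε₁ : 0 < ε₁) :
    ∃ J : ℕ, a * (2 / 3 : ℝ) ^ J ≤ t ∧ ((2:ℝ) ^ J)⁻¹ ≤ ε₁ := by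
  obtain ⟨J₁, hJ₁⟩ := exists_pow_lt_of_lt_one (show 0 < t / (a + 1) by positivity)
    (show (2 / 3 : ℝ) < 1 by norm_num)
  obtain ⟨J₂, hJ₂⟩ := exists_pow_lt_of_lt_one hε₁ (show (1 / 2 : ℝ) < 1 by norm_num)
  refine ⟨J₁ + J₂, ?_, ?_⟩
  · have h1 : (2 / 3 : ℝ) ^ (J₁ + J₂) ≤ (2 / 3) ^ J₁ :=
      pow_le_pow_of_le_one (by norm_num) (by norm_num) (Nat.le_add_right _ _)
    have h2 : a * (t / (a + 1)) ≤ t := by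
      rw [mul_div_assoc']
      rw [div_le_iff₀ (by positivity)]
      nlinarith
    calc a * (2 / 3 : ℝ) ^ (J₁ + J₂) ≤ a * (2 / 3) ^ J₁ := mul_le_mul_of_nonneg_left h1 ha
      _ ≤ a * (t / (a + 1)) := mul_le_mul_of_nonneg_left hJ₁.le ha
      _ ≤ t := h2
  · have h1 : (1 / 2 : ℝ) ^ (J₁ + J₂) ≤ (1 / 2) ^ J₂ :=
      pow_le_pow_of_le_one (by norm_num) (by norm_num) (Nat.le_add_left _ _)
    rw [← one_div, ← one_div_pow]
    exact h1.trans hJ₂.le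

/-- The bulk test function `shell[ε,M]·φ` satisfies the hypotheses of the bulk convergence theorem.
[folklore] -/
theorem tendsto_bulkSum (hlim : HasPointwiseScalingLimit (criticalCorr 3) ρ S)
    {φ : E3 → ℝ} (hφc : Continuous φ) {B M ε : ℝ} (hB : ∀ y, |φ y| ≤ B) (hε : 0 < ε) :
    Tendsto (fun L : ℝ => (L⁻¹) ^ 3 * ρ L⁻¹ ^ 2 *
        ∑' x : Site 3, shell[ε, M] (L⁻¹ • siteVec x) * φ (L⁻¹ • siteVec x) * criticalTwoPoint 3 x)
      atTop (𝓝 (∫ y, shell[ε, M] y * (φ y * S 2 ![0, y]))) := by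
  have hB0 : 0 ≤ B := (abs_nonneg _).trans (hB 0)
  have h := tendsto_scaled_latticeSum hlim (Ψ := fun y => shell[ε, M] y * φ y) (B := B) (ε := ε)
    (M := M) (fun y => ?_) hε (fun y hy => ?_) (fun y hy => ?_) ?_
  · have h' := h.comp tendsto_inv_atTop_nhdsGT_zero
    have heq : (∫ y, shell[ε, M] y * φ y * S 2 ![0, y]) = ∫ y, shell[ε, M] y * (φ y * S 2 ![0, y]) :=
      integral_congr_ae (Eventually.of_forall fun y => mul_assoc _ _ _)
    rw [heq] at h'
    exact h'
  · rw [abs_mul]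
    calc |shell[ε, M] y| * |φ y| ≤ 1 * B :=
          mul_le_mul (abs_shell_le _ _ _) (hB y) (abs_nonneg _) zero_le_one
      _ = B := one_mul B
  · show shell[ε, M] y * φ y = 0
    rw [shell_eq_zero_of_lt hy, zero_mul]
  · show shell[ε, M] y * φ y = 0
    rw [shell_eq_zero_of_gt hy, zero_mul]
  · filter_upwards [ae_continuousAt_shell ε M] with y hy
    exact hy.mul hφc.continuousAt

/-- The shell-ratio threshold in the scale variable `L = δ⁻¹`: beyond some `L₀ ≥ 1`,
`Σ_{L/4<‖x‖≤L/2} ⟨σ₀σ_x⟩ ≤ (2/3) Σ_{L/2<‖x‖≤L} ⟨σ₀σ_x⟩`. [folklore] -/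
theorem exists_ratio_scale (hρ : ∀ δ ∈ Set.Ioc (0:ℝ) 1, 0 < ρ δ)
    (hlim : HasPointwiseScalingLimit (criticalCorr 3) ρ S) (hsc : IsScaleCovariant Δ S)
    (hΔ : Δ ≤ 1) (hcont : ContinuousOn (fun y : E3 => S 2 ![0, y]) {0}ᶜ)
    (hpos : ∀ y : E3, y ≠ 0 → 0 < S 2 ![0, y]) :
    ∃ L₀ : ℝ, 1 ≤ L₀ ∧ ∀ L, L₀ ≤ L →
      ∑' x : Site 3, shell[1 / 2, 1] ((L / 2)⁻¹ • siteVec x) * criticalTwoPoint 3 x ≤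
        2 / 3 * ∑' x : Site 3, shell[1 / 2, 1] (L⁻¹ • siteVec x) * criticalTwoPoint 3 x := by
  have hev := tendsto_inv_atTop_nhdsGT_zero.eventually
    (eventually_shellSum_ratio hρ hlim hsc hΔ hcont hpos)
  obtain ⟨L₁, hL₁⟩ := eventually_atTop.1 hev
  refine ⟨max L₁ 1, le_max_right _ _, fun L hL => ?_⟩
  have h := hL₁ L ((le_max_left _ _).trans hL)
  have hrw : ∀ x : Site 3,
      shell[1 / 2, 1] ((L / 2)⁻¹ • siteVec x) = shell[1 / 4, 1 / 2] (L⁻¹ • siteVec x) := by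
    intro x
    rw [show (L / 2)⁻¹ • siteVec x = (2:ℝ) • (L⁻¹ • siteVec x) by
      rw [smul_smul, inv_div, div_eq_mul_inv], shell_two_smul]
    norm_num
  simp only [hrw]
  exact h

/-- The final bookkeeping of the ratio theorem, as a statement about real numbers: bulk parts
`b`, origin parts `o ≤ B·mJ`, geometric decay `mJ ≤ m₀ + 3qD`, and the scaled limits. [folklore] -/
theorem ratio_arith {c b1 bT o1 oT mJ m₀ D B η I₁ Iε J₁₂ q : ℝ} (hc : 0 < c) (hB0 : 0 ≤ B)
    (hη : 0 < η) (hI₁ : 0 < I₁) (hIε : I₁ ≤ Iε)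
    (h2 : Iε - η * I₁ / 16 < c * b1) (h3 : c * b1 < Iε + η * I₁ / 16)
    (h4 : Iε - η * I₁ / 16 < c * bT) (h5 : c * bT < Iε + η * I₁ / 16)
    (h2' : Iε - I₁ / 2 < c * b1) (h6 : c * m₀ < η * I₁ / (16 * (B + 1)))
    (h7 : c * D < J₁₂ + 1) (ho1 : 0 ≤ o1) (hoT : 0 ≤ oT) (ho1le : o1 ≤ B * mJ)
    (hoTle : oT ≤ B * mJ) (hmJ : mJ ≤ m₀ + 3 * q * D) (hq : 0 ≤ q)
    (hJ1 : 2 * B * (3 * (J₁₂ + 1)) * q ≤ η * I₁ / 8) :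
    |(bT + oT) / (b1 + o1) - 1| < η := by
  have hcb1' : I₁ / 2 ≤ c * b1 := by linarith
  have hb1pos : 0 < b1 := pos_of_mul_pos_right (by linarith) hc.le
  have hN1pos : 0 < b1 + o1 := by linarith
  rw [div_sub_one hN1pos.ne', abs_div, abs_of_pos hN1pos, div_lt_iff₀ hN1pos]
  have habs : |bT + oT - (b1 + o1)| ≤ |bT - b1| + B * mJ := by
    have hoo : |oT - o1| ≤ B * mJ := abs_sub_le_iff.2 ⟨by linarith, by linarith⟩
    calc |bT + oT - (b1 + o1)| = |(bT - b1) + (oT - o1)| := by ring_nf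
      _ ≤ |bT - b1| + |oT - o1| := abs_add_le _ _
      _ ≤ |bT - b1| + B * mJ := by linarith
  have hcb : c * |bT - b1| < η * I₁ / 8 := by
    rw [← abs_of_pos hc, ← abs_mul, mul_sub, abs_sub_lt_iff]
    constructor <;> linarith
  have hcm : c * (B * mJ) ≤ η * I₁ / 8 := by
    have h1 : c * mJ ≤ c * m₀ + 3 * q * (c * D) := by
      calc c * mJ ≤ c * (m₀ + 3 * q * D) := mul_le_mul_of_nonneg_left hmJ hc.le
        _ = c * m₀ + 3 * q * (c * D) := by ring
    have h2a : 3 * q * (c * D) ≤ 3 * q * (J₁₂ + 1) :=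
      mul_le_mul_of_nonneg_left h7.le (by positivity)
    have h3a : B * (η * I₁ / (16 * (B + 1))) ≤ η * I₁ / 16 := by
      rw [mul_div_assoc', div_le_div_iff₀ (by positivity) (by positivity)]
      nlinarith [mul_pos hη hI₁]
    have h4a : B * (3 * q * (J₁₂ + 1)) ≤ η * I₁ / 16 := by linarith
    calc c * (B * mJ) = B * (c * mJ) := by ring
      _ ≤ B * (c * m₀ + 3 * q * (c * D)) := mul_le_mul_of_nonneg_left h1 hB0
      _ ≤ B * (η * I₁ / (16 * (B + 1)) + 3 * q * (J₁₂ + 1)) :=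
          mul_le_mul_of_nonneg_left (by linarith) hB0
      _ = B * (η * I₁ / (16 * (B + 1))) + B * (3 * q * (J₁₂ + 1)) := by ring
      _ ≤ η * I₁ / 16 + η * I₁ / 16 := add_le_add h3a h4a
      _ = η * I₁ / 8 := by ring
  have hfin : c * (|bT - b1| + B * mJ) < c * (η * (b1 + o1)) := by
    have h1 : c * (|bT - b1| + B * mJ) < η * I₁ / 4 := by
      have : c * (|bT - b1| + B * mJ) = c * |bT - b1| + c * (B * mJ) := by ring
      linarith
    have h2 : η * I₁ / 4 < η * (I₁ / 2) := by nlinarith [mul_pos hη hI₁]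
    have h3 : η * (I₁ / 2) ≤ η * (c * b1) := mul_le_mul_of_nonneg_left hcb1' hη.le
    have h4 : η * (c * b1) ≤ c * (η * (b1 + o1)) := by
      have h5 : 0 ≤ c * (η * o1) := mul_nonneg hc.le (mul_nonneg hη.le ho1)
      have h6 : c * (η * (b1 + o1)) = η * (c * b1) + c * (η * o1) := by ring
      linarith
    linarith
  exact lt_of_le_of_lt habs (lt_of_mul_lt_mul_left hfin hc.le)

/-! ### The ratio theorem -/

/-- **The ratio theorem.** Let `S` be a pointwise scaling limit of the critical `ℤ³` Ising
correlators (renormalisation `ρ > 0` on `(0,1]`) which is non-degenerate, translation invariant and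
scale covariant with dimension `Δ`. Then for every continuous `φ ≥ 0` on `ℝ³`, bounded, vanishing
outside a ball and positive somewhere, and every linear isometry `T` of `ℝ³`,
`Σ_x φ(T(x/L)) ⟨σ₀σ_x⟩_{β_c} / Σ_x φ(x/L) ⟨σ₀σ_x⟩_{β_c} → 1` as `L → ∞`.
Proof: split both sums at `‖x‖ = 2^{-J} L`. The bulk parts, multiplied by `L⁻³ρ(1/L)²`, converge to
`∫_{‖y‖>2^{-J}} φ∘T · K = ∫_{‖y‖>2^{-J}} φ K > 0` (bulk convergence, and invariance of `K = S₂(0,·)`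
— `kernel_rotation_invariant`, nine-mirror RP rigidity — and of Lebesgue measure under `T`); the
origin parts are at most `‖φ‖_∞ · mass(L/2^J) ≤ ‖φ‖_∞ (m₀ + 3(2/3)^J Σ_{L/2<‖x‖≤L})` by the geometric
decay of the lattice mass, i.e. `O((2/3)^J)` relative to the bulk, uniformly in large `L`.
[cite: DuminilCopinICM2022, §8.1] -/
theorem tendsto_ratio_of_limit (hρ : ∀ δ ∈ Set.Ioc (0:ℝ) 1, 0 < ρ δ)
    (hlim : HasPointwiseScalingLimit (criticalCorr 3) ρ S) (hnd : IsNondegenerateTwoPoint S)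
    (htr : IsTranslationInvariant S) (hsc : IsScaleCovariant Δ S)
    {φ : E3 → ℝ} (hφc : Continuous φ) {B M : ℝ} (hB : ∀ y, |φ y| ≤ B)
    (hφM : ∀ y, M < ‖y‖ → φ y = 0) (hφ0 : ∀ y, 0 ≤ φ y) (hφpos : ∃ y, 0 < φ y)
    (T : E3 ≃ₗᵢ[ℝ] E3) :
    Tendsto (fun L : ℝ => (∑' x : Site 3, φ (T (L⁻¹ • siteVec x)) * criticalTwoPoint 3 x) /
      (∑' x : Site 3, φ (L⁻¹ • siteVec x) * criticalTwoPoint 3 x)) atTop (𝓝 1) := by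
  -- kernel facts
  have hΔ1 : Δ ≤ 1 := (window hρ hlim hnd hsc).2
  have hKcont : ContinuousOn (fun y : E3 => S 2 ![0, y]) {0}ᶜ := kernel_continuousOn hlim
  have hKpos : ∀ y : E3, y ≠ 0 → 0 < S 2 ![0, y] := kernel_pos hnd
  have hKT : ∀ y : E3, S 2 ![0, T y] = S 2 ![0, y] :=
    kernel_rotation_invariant hρ hlim hnd htr hsc T
  have hB0 : 0 ≤ B := (abs_nonneg _).trans (hB 0)
  -- the rotated test function
  have hφTc : Continuous fun y => φ (T y) := hφc.comp T.continuous
  have hφTM : ∀ y, M < ‖y‖ → φ (T y) = 0 := fun y hy =>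
    hφM _ (by rwa [LinearIsometryEquiv.norm_map])
  have hφTB : ∀ y, |φ (T y)| ≤ B := fun y => hB _
  have hφT0 : ∀ y, 0 ≤ φ (T y) := fun y => hφ0 _
  -- the positivity scale `ε₁` and `I₁ > 0` (all real constants below are kept opaque)
  obtain ⟨ε₁, hε₁, hI₁'⟩ := exists_pos_bulk_integral hKcont hKpos hφc hφM hφ0 hφpos
  obtain ⟨I₁, hI₁def⟩ : ∃ I : ℝ, I = ∫ y, shell[ε₁, M] y * (φ y * S 2 ![0, y]) := ⟨_, rfl⟩
  have hI₁ : 0 < I₁ := by rw [hI₁def]; exact hI₁'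
  -- the shell-ratio scale `L₀` and the core mass `m₀`
  obtain ⟨L₀, hL₀1, hratio⟩ := exists_ratio_scale hρ hlim hsc hΔ1 hKcont hKpos
  have hL₀ : 0 < L₀ := one_pos.trans_le hL₀1
  obtain ⟨m₀, hm₀def⟩ : ∃ m : ℝ, m = ∑' x : Site 3, ballInd[L₀] (siteVec x) * criticalTwoPoint 3 x :=
    ⟨_, rfl⟩
  have hm₀0 : 0 ≤ m₀ := by rw [hm₀def]; exact mass_nonneg L₀
  obtain ⟨J₁₂, hJ₁₂def⟩ : ∃ I : ℝ, I = ∫ y, shell[1 / 2, 1] y * S 2 ![0, y] := ⟨_, rfl⟩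
  -- the two model limits along `L → ∞`
  have hc0 : Tendsto (fun L : ℝ => (L⁻¹) ^ 3 * ρ L⁻¹ ^ 2) atTop (𝓝 0) :=
    (tendsto_cube_mul_rho_sq hlim).comp tendsto_inv_atTop_nhdsGT_zero
  have hD : Tendsto (fun L : ℝ => (L⁻¹) ^ 3 * ρ L⁻¹ ^ 2 *
      ∑' x : Site 3, shell[1 / 2, 1] (L⁻¹ • siteVec x) * criticalTwoPoint 3 x) atTop (𝓝 J₁₂) := by
    rw [hJ₁₂def]
    exact (tendsto_shellSum hlim (a := 1 / 2) (b := 1) (by norm_num)).comp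
      tendsto_inv_atTop_nhdsGT_zero
  have hJ₁₂0 : 0 ≤ J₁₂ := by
    refine ge_of_tendsto hD ?_
    filter_upwards [eventually_ge_atTop (1:ℝ)] with L hL
    have hLpos : 0 < L := one_pos.trans_le hL
    exact mul_nonneg (mul_nonneg (pow_nonneg (inv_nonneg.2 hLpos.le) 3) (sq_nonneg _))
      (tsum_nonneg fun x => mul_nonneg (Set.indicator_nonneg (fun _ _ => zero_le_one) _)
        (criticalTwoPoint_nonneg' x))
  -- ε-criterion
  rw [Metric.tendsto_nhds]
  intro η hη
  -- the dyadic depth `J` and the inner radius `ε = 2^{-J}`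
  obtain ⟨J, hJ1, hJ2⟩ := exists_depth (a := 2 * B * (3 * (J₁₂ + 1))) (t := η * I₁ / 8)
    (by positivity) (by positivity) hε₁
  set ε : ℝ := ((2:ℝ) ^ J)⁻¹ with hεdef
  have hε : 0 < ε := by positivity
  obtain ⟨Iε, hIεdef⟩ : ∃ I : ℝ, I = ∫ y, shell[ε, M] y * (φ y * S 2 ![0, y]) := ⟨_, rfl⟩
  have hIε : I₁ ≤ Iε := by
    rw [hI₁def, hIεdef]
    exact bulk_integral_mono hKcont hKpos hφc hφ0 hε hJ2
  -- bulk limits (the rotated one has the same limit, by rotation invariance of `K` and Lebesgue)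
  have hb1 := tendsto_bulkSum hlim hφc (M := M) (ε := ε) hB hε
  rw [← hIεdef] at hb1
  have hbT := tendsto_bulkSum hlim hφTc (M := M) (ε := ε) hφTB hε
  rw [bulk_integral_comp_isometry T hKT φ ε M, ← hIεdef] at hbT
  -- eventualities along `L → ∞`
  have e1 := eventually_ge_atTop L₀
  have hsmall : 0 < η * I₁ / 16 := by positivity
  have e2 := (tendsto_order.1 hb1).1 _ (show Iε - η * I₁ / 16 < Iε by linarith)
  have e3 := (tendsto_order.1 hb1).2 _ (show Iε < Iε + η * I₁ / 16 by linarith)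
  have e4 := (tendsto_order.1 hbT).1 _ (show Iε - η * I₁ / 16 < Iε by linarith)
  have e5 := (tendsto_order.1 hbT).2 _ (show Iε < Iε + η * I₁ / 16 by linarith)
  have e2' := (tendsto_order.1 hb1).1 _ (show Iε - I₁ / 2 < Iε by linarith)
  have e6 : ∀ᶠ L : ℝ in atTop, (L⁻¹) ^ 3 * ρ L⁻¹ ^ 2 * m₀ < η * I₁ / (16 * (B + 1)) := by
    have h := hc0.mul_const m₀
    rw [zero_mul] at h
    exact (tendsto_order.1 h).2 _ (by positivity)
  have e7 := (tendsto_order.1 hD).2 _ (show J₁₂ < J₁₂ + 1 by linarith)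
  filter_upwards [e1, e2, e3, e4, e5, e2', e6, e7] with L hL1 h2 h3 h4 h5 h2' h6 h7
  -- facts about the pieces at scale `L` (with the explicit terms)
  have hLpos : 0 < L := hL₀.trans_le hL1
  have hL1' : 1 ≤ L := hL₀1.trans hL1
  have hc : 0 < (L⁻¹) ^ 3 * ρ L⁻¹ ^ 2 := mul_pos (pow_pos (inv_pos.2 hLpos) 3)
    (pow_pos (hρ _ ⟨inv_pos.2 hLpos, inv_le_one_of_one_le₀ hL1'⟩) 2)
  have hN1 := tsum_sample_eq_bulk_add_origin hLpos hφM ε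
  have hNT := tsum_sample_eq_bulk_add_origin (φ := fun y => φ (T y)) hLpos hφTM ε
  have ho1 := origin_nonneg hφ0 ε L
  have hoT := origin_nonneg hφT0 ε L
  have hεL : ε * L = L / 2 ^ J := by rw [hεdef, inv_mul_eq_div]
  have ho1le := origin_le_mass (ε := ε) hLpos hB hφM
  have hoTle := origin_le_mass (φ := fun y => φ (T y)) (ε := ε) hLpos hφTB hφTM
  rw [hεL] at ho1le hoTle
  have hmJ := mass_dyadic_le hL₀ hratio hL1 J
  rw [← hm₀def] at hmJ
  rw [Real.dist_eq, hN1, hNT]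
  exact ratio_arith hc hB0 hη hI₁ hIε h2 h3 h4 h5 h2' h6 h7 ho1 hoT ho1le hoTle hmJ
    (by positivity) hJ1

/-! ### The conditional milestone -/

/-- **`ExistsScaleCovariantLimit → TwoPointAsymptoticIsotropy`** (route HarmonicMomentsIsotropy,
item stmt-CriticalPhenomena-6036 made conditional on the shared crux stmt-CriticalPhenomena-1981).
If the critical `ℤ³` Ising correlators admit a pointwise scaling limit `S` (renormalisation `ρ > 0`
on `(0,1]`) which is normalised, non-degenerate, translation invariant and scale covariant, then the
critical two-point function is asymptotically rotation invariant in the vague sense: for every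
continuous compactly supported `φ ≥ 0`, `φ ≢ 0`, on `ℝ³` and every `R ∈ O(3)`,
`Σ_x φ(Rx/L)⟨σ₀σ_x⟩_{β_c} / Σ_x φ(x/L)⟨σ₀σ_x⟩_{β_c} → 1` as `L → ∞`. The rotation is the tree's
continuum two-point isotropy `kernel_rotation_invariant` (nine-mirror RP rigidity, route
HyperoctahedralRP); this line supplies the lattice-to-continuum transfer. Rotation invariance of the
critical limit on `ℤ³` itself remains open (Duminil-Copin, ICM 2022, §8.1).
[cite: DuminilCopinICM2022, §8.1] -/
theorem twoPointAsymptoticIsotropy_of_existsScaleCovariantLimit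
    (hEX : ExistsScaleCovariantLimit) : TwoPointAsymptoticIsotropy := by
  obtain ⟨ρ, Δ, S, hρ, -, hlim, -, hnd, htr, hsc⟩ := hEX
  intro φ hφc hφs hφ0 hφpos R
  -- the orthogonal matrix as a linear isometry of `EuclideanSpace ℝ (Fin 3)`
  obtain ⟨T, hT⟩ := exists_linearIsometryEquiv_of_orthogonal R
  -- the test function on `EuclideanSpace ℝ (Fin 3)`
  set φE : E3 → ℝ := fun y => φ y.ofLp with hφE
  have hφEc : Continuous φE := hφc.comp (PiLp.continuous_ofLp 2 _)
  obtain ⟨B, hB⟩ : ∃ B, ∀ y, |φE y| ≤ B := by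
    obtain ⟨C, hC⟩ := hφc.bounded_above_of_compact_support hφs
    exact ⟨C, fun y => by rw [← Real.norm_eq_abs]; exact hC _⟩
  obtain ⟨M₀, hM₀⟩ : ∃ M₀ : ℝ, ∀ v : Fin 3 → ℝ, M₀ < ‖v‖ → φ v = 0 := by
    obtain ⟨C, hC⟩ := hφs.isCompact.isBounded.exists_norm_le
    refine ⟨C, fun v hv => image_eq_zero_of_notMem_tsupport fun hmem => ?_⟩
    exact absurd (hC v hmem) (not_le.2 hv)
  have hφEM : ∀ y : E3, 2 * M₀ < ‖y‖ → φE y = 0 := by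
    intro y hy
    refine hM₀ _ ?_
    have := norm_le_two_mul_norm_ofLp y
    linarith
  have hφE0 : ∀ y, 0 ≤ φE y := fun y => hφ0 _
  have hφEpos : ∃ y, 0 < φE y := by
    obtain ⟨v, hv⟩ := hφpos
    exact ⟨WithLp.toLp 2 v, by simpa [hφE] using hv⟩
  have hmain := tendsto_ratio_of_limit hρ hlim hnd htr hsc hφEc hB hφEM hφE0 hφEpos T
  -- identify the sums
  refine hmain.congr fun L => ?_
  have h1 : ∀ x : Site 3, φE (T (L⁻¹ • siteVec x)) =
      φ (L⁻¹ • (R.1.mulVec fun i => (x i : ℝ))) := by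
    intro x
    simp only [hφE, hT, WithLp.ofLp_smul, Matrix.mulVec_smul]
    rfl
  have h2 : ∀ x : Site 3, φE (L⁻¹ • siteVec x) = φ (L⁻¹ • fun i => (x i : ℝ)) := by
    intro x
    simp only [hφE, WithLp.ofLp_smul]
    rfl
  simp only [h1, h2]

/-- **Consequence for the route's assembly.** Given the shared crux `ExistsScaleCovariantLimit`, the
sub-problem statement follows from the three remaining shared cruxes `RotationUpgrade`,
`InversionUpgradeNormalised` and `IsingEuclidUpgradeR4NonGaussian` alone — the route's own cruxes
`AngularHierarchy`, `CorrelationLengthWindow` and the glue `DilutionTransfer` / `HierarchyClosure` /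
`HarmonicDilution` are not needed: the two-point isotropy input of `RotationUpgrade` is
`twoPointAsymptoticIsotropy_of_existsScaleCovariantLimit`, Euclidean invariance is translation
(from the crux) plus rotation (the upgrade), Möbius covariance adds scale (crux) and inversion
(`InversionUpgradeNormalised`), and `U₄ ≢ 0` is the last crux. (Pure logic on the route decls; recorded
for the planner — the route's deciding theorem `closes` keeps all eleven hypotheses.)
[cite: DuminilCopinICM2022, §8.1] -/
theorem ising3DConformalLimit_of_existsScaleCovariantLimit (hEX : ExistsScaleCovariantLimit)
    (hRU : RotationUpgrade) (hINV : InversionUpgradeNormalised)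
    (hU4 : IsingEuclidUpgradeR4NonGaussian) : _root_.Ising3DConformalLimit := by
  have hISO : TwoPointAsymptoticIsotropy := twoPointAsymptoticIsotropy_of_existsScaleCovariantLimit hEX
  obtain ⟨ρ, Δ, S, hρ, hΔ, hlim, hS0, hnd, htr, hsc⟩ := hEX
  have hrot : IsRotationInvariant S := hRU hISO ρ Δ S hρ hlim hS0 hnd htr hsc
  have heuc : IsEuclideanInvariant S := ⟨htr, hrot⟩
  have hinv : IsInversionCovariant Δ S := hINV ρ Δ S hρ hlim hS0 hnd heuc hsc
  exact ⟨ρ, Δ, S, hρ, hΔ, hlim, hnd, ⟨heuc, hsc, hinv⟩, hU4 ρ S hρ hlim hnd⟩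


end Summit.CriticalPhenomena.Ising3DConformalLimit.HarmonicMomentsIsotropyTwoPoint

end
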